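import Mathlib
import HarnessLib
import Summits.ResolutionOfSingularities.ResolutionOfSingularities.Theorems.WildQuotientsWildQuotientResolutionS1aKillCertAway
import Summits.ResolutionOfSingularities.ResolutionOfSingularities.Theorems.WildQuotientsWildQuotientResolutionS1aRingKillDataOfCert
import Summits.ResolutionOfSingularities.ResolutionOfSingularities.Theorems.WildQuotientsWildQuotientResolutionS1aVeroneseNormalisation

/-!
# S1a — SECOND-LEVEL `RingKillData` ON A CHART NODE FROM ONE CERTIFICATE ON `R^w`

[OURS · L1 W4.5c · lead-1 g10; FRAME-STATUS rev11 §4 item 3] — NOT statements of the manuscript; counted 0; AI-level work, weaker than expert review.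
Crux stmt-ResolutionOfSingularities-17941 `CyclicQuotientFourfolds`, line `s1a-logminvertex` v10; the producer of the per-chart hypothesis `hdata` of
`killableAt_over_of_ringKillData` (p628829) / `auxChartsAt_of_ringData` (p629686). Route-independent.

A SECOND-LEVEL weighted centre `(f', w')` given ONCE on the first-level cobordant algebra `R^w = cobordantAlgebra f w` (σ_R-adapted, K1′-regular), with a
cobordant kill certificate for `σ_R`, gives `RingKillData` on the chart node `(ChartRing 𝒜 f w d b hb, chartNodeGrading, sigmaChart)` of every σ-fixed chart the
centre MEETS — provided the image frame is homogeneous for the chart node grading (hypothesis `hf'`, checkable by `mem_chartGrading_iff`) and the chart node is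
tame (hypothesis `htame`, supplied by `exists_nodeData_blowupChart`).
* ★★ `ringKillData_chart_of_cert` — by `CobordantKillCert.chart` (p641020 v2), K1′-transfer to the localisation (`CentreAway.isRegular_ofFn_map`,
  `isRegularRing_quotient_span_map`), a Veronese degree from the chart node's (T2) (`veroneseNormalisation`), and KC2.
-/

set_option linter.dupNamespace false

noncomputable section

open Literature.AlgebraicGeometry.Resolution
open scoped LaurentPolynomial
open Summit.ResolutionOfSingularities.ResolutionOfSingularities.Theorems.WildQuotientResolution.S1
open Summit.ResolutionOfSingularities.ResolutionOfSingularities.Theorems.WildQuotientResolution.S1.ProducerStep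
open Summit.ResolutionOfSingularities.ResolutionOfSingularities.Theorems.WildQuotientResolution.S1.CoarseChart
open Summit.ResolutionOfSingularities.ResolutionOfSingularities.Theorems.WildQuotientResolution.S1.NodeAway
open Summit.ResolutionOfSingularities.ResolutionOfSingularities.Theorems.WildQuotientResolution.S1.CentreAway
open Summit.ResolutionOfSingularities.ResolutionOfSingularities.Theorems.WildQuotientResolution.S1.PrincipalAway
open Summit.ResolutionOfSingularities.ResolutionOfSingularities.Theorems.WildQuotientResolution.S1.BlowupCharts

namespace Summit.ResolutionOfSingularities.ResolutionOfSingularities.Theorems.WildQuotientResolution.S1.KillCert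

universe u

variable {p : ℕ} {m : ℕ} (r : Fin m → ℕ) {B : Type u} [CommRing B] (𝒜 : (Π j : Fin m, ZMod (r j)) → AddSubgroup B) [GradedRing 𝒜]
  {c : ℕ} (f : Fin c → B) {δ : Fin c → Π j : Fin m, ZMod (r j)} (w : Fin c → ℕ) (hf : ∀ i, f i ∈ 𝒜 (δ i))
  {d : ℕ} (b : ↥(𝒜 0)) (hb : b ∈ (traceFiltration 𝒜 f w).ideal d) (σ : B ≃+* B)
  (hσJ : ∀ n : ℕ, ((weightedFiltration f w).ideal n).map (σ : B →+* B) ≤ (weightedFiltration f w).ideal n)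
  (hp : 0 < p) (hσp : ∀ x : B, (⇑σ)^[p] x = x) (hσb : σ (b : B) = b)

/-- ★★ **SECOND-LEVEL `RingKillData` ON A CHART NODE FROM ONE CERTIFICATE ON `R^w`.** Let `(f', δ', w')` be a weighted centre on `R^w` (`0 < c'`, positive
weights, K1′-regular, σ_R-adapted) with a cobordant kill certificate for `σ_R` (e.g. by KC3 on `R^w`), whose image on the chart ring `R^w[(bT^d)⁻¹]` is
homogeneous for `chartNodeGrading` and PROPER (the centre meets the chart); let the chart node be tame. Then
`RingKillData p (cons 0 r) (ChartRing 𝒜 f w d b hb) (chartNodeGrading …) (sigmaChart …)` — the per-chart hypothesis of `killableAt_over_of_ringKillData`.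
[OURS · L1 W4.5c · FRAME-STATUS rev11 §4 (3); NOT a statement of the manuscript] -/
theorem ringKillData_chart_of_cert
    (htame : letI := chartNodeGradedRing r 𝒜 f w hf d b hb
      IsTameNode p (ChartRing 𝒜 f w d b hb) (chartNodeGrading r 𝒜 f w hf d b hb) (sigmaChart 𝒜 f w d b hb σ hσJ hp hσp hσb))
    {c' : ℕ} (f' : Fin c' → ↥(cobordantAlgebra f w)) (δ' : Fin c' → Π j : Fin (m + 1), ZMod ((Fin.cons 0 r : Fin (m + 1) → ℕ) j))
    (w' : Fin c' → ℕ) (hc' : 0 < c') (hw' : ∀ i, 0 < w' i)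
    (hf' : ∀ i, algebraMap (↥(cobordantAlgebra f w)) (ChartRing 𝒜 f w d b hb) (f' i) ∈ chartNodeGrading r 𝒜 f w hf d b hb (δ' i))
    (hK1 : RingTheory.Sequence.IsRegular (↥(cobordantAlgebra f w)) (List.ofFn f'))
    (hK1' : IsRegularRing (↥(cobordantAlgebra f w) ⧸ Ideal.span (Set.range f')))
    (hne : (Ideal.span (Set.range f')).map (algebraMap (↥(cobordantAlgebra f w)) (ChartRing 𝒜 f w d b hb)) ≠ ⊤)
    (hσJ' : ∀ n : ℕ, ((weightedFiltration f' w').ideal n).map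
      (sigmaR σ f w hσJ hp hσp : ↥(cobordantAlgebra f w) →+* ↥(cobordantAlgebra f w)) ≤ (weightedFiltration f' w').ideal n)
    (hcert : ∃ g, CobordantKillCert f' w' (sigmaR σ f w hσJ hp hσp) hσJ' hp (sigmaR_iterate_eq σ f w hσJ hp hσp) g) :
    letI := chartNodeGradedRing r 𝒜 f w hf d b hb
    RingKillData p (Fin.cons 0 r : Fin (m + 1) → ℕ) (ChartRing 𝒜 f w d b hb) (chartNodeGrading r 𝒜 f w hf d b hb)
      (sigmaChart 𝒜 f w d b hb σ hσJ hp hσp hσb) := by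
  letI := chartNodeGradedRing r 𝒜 f w hf d b hb
  haveI : IsRegularRing (↥(cobordantAlgebra f w) ⧸ Ideal.span (Set.range f')) := hK1'
  -- a Veronese degree of the image centre from (T2) of the chart node
  obtain ⟨D, hD⟩ := Veronese.veroneseNormalisation _ _ (chartNodeGrading r 𝒜 f w hf d b hb) htame.2.2.2.1 c'
    (algebraMap (↥(cobordantAlgebra f w)) (ChartRing 𝒜 f w d b hb) ∘ f') δ' w' hf'
  obtain ⟨g, hg⟩ := hcert
  refine ringKillData_of_cert (Fin.cons 0 r : Fin (m + 1) → ℕ) (ChartRing 𝒜 f w d b hb) (chartNodeGrading r 𝒜 f w hf d b hb)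
    (sigmaChart 𝒜 f w d b hb σ hσJ hp hσp hσb) (algebraMap (↥(cobordantAlgebra f w)) (ChartRing 𝒜 f w d b hb) ∘ f') δ' w' D hc' hf' hw'
    (isRegular_ofFn_map (ChartRing 𝒜 f w d b hb) (Submonoid.powers (coverElement 𝒜 f w d b hb)) f' hK1 hne)
    (isRegularRing_quotient_span_map (ChartRing 𝒜 f w d b hb) (Submonoid.powers (coverElement 𝒜 f w d b hb)) f')
    (map_sigmaAway_weightedFiltration_le f' w' (sigmaR σ f w hσJ hp hσp) (sigmaR_coverElement 𝒜 f w d b hb σ hσJ hp hσp hσb) hσJ')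
    hD fun hp' hσp' => ⟨_, CobordantKillCert.chart 𝒜 f w b hb σ hσJ hp hσp hσb f' w' hσJ' hg⟩

end Summit.ResolutionOfSingularities.ResolutionOfSingularities.Theorems.WildQuotientResolution.S1.KillCert

end
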